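import Mathlib.Combinatorics.SimpleGraph.Acyclic
import Mathlib.Combinatorics.SimpleGraph.Metric
import HarnessLib

/-!
# The nearest-point RETRACTION of a tree onto a connected set of vertices: height, parent toward the subtree, «every edge off the subtree is a parent edge»,
# and equivariance under automorphisms preserving the subtree (Serre, *Trees* (1980), I.2 Prop. 8 ff., I.6.4)

Topic `Combinatorics/SimpleGraph`; namespace `Literature.Combinatorics.SimpleGraph.TreeRetraction`.  THEOREMS ONLY (no definition, no instance, no notation,
no named fact, no `sorry`); Mathlib-only; arbitrary vertex type.  Cell `pub/hodgecm-mathlib`, F0∕P3a, crux H413 = stmt-HodgeConjecture-24833, line «N6nsGerm»,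
(R2) Euler–Poincaré road, RAMIFIED half census `F0/P3a/A-p06/g27/CENSUS-R2ram-RamifiedEulerPoincare.A-p06g27.md` §4 (N2b-graph) (LEAD F0P3a-plan (g10) T9-6 (2) ∕
T9-8 (B); seat A-p06 (g27); co-hand A-p17 (g22): her (T1) `HermitianLatticeTreeRankTwo` supplies `IsTree`).  HONEST LABEL: HC_CM is proved only modulo the
printed citations until rung 0 closes; pure graph theory here.

THE MATHEMATICS.  `G` a tree on `V`, `Y ⊆ V` non-empty with `G.induce Y` connected (a subtree; in the application: the apartment of the split torus in the
Bruhat–Tits tree of `U(Φ₂)_v`, a bi-infinite path).  Put `h(v) := dist(v, Y)` and, for `v ∉ Y`, `p(v)` := the first vertex of a shortest path from `v` to `Y`.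
Then: `h(v) = 0 ↔ v ∈ Y`; `v ~ p(v)`, `h(p v) + 1 = h(v)`; **every other neighbour `w` of `v ∉ Y` has `h(w) = h(v) + 1` and `p(w) = v`** (if a second
neighbour led down, the two descents, joined inside `Y`, would give a second path `u ⇝ w` avoiding `v`, against uniqueness of paths in a tree); hence EVERY
edge not inside `Y` is a parent edge — exactly the hypothesis `hedge` of ★ `Literature.GroupTheory.natCard_quotient_tube` (A-p06 (N2a)) and of ★
`RootedTree.isTree_of_parent` (A-p17 FILE G, the case `Y = {r}`) — and `h`, `p` are EQUIVARIANT under every automorphism of `G` mapping `Y` onto itself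
(uniqueness of the down-neighbour).  Packaged as ONE existence statement (`h`, `p` are not definitions of the tree: theorems-only file).

* `exists_walk_mem_of_induce_connected` — a walk inside `Y` between two points of `Y`.  (Automorphisms are isometries: ★ `Literature.Probability.MarkovChains.dist_iso`;
  only the one-line «does not increase distance» half is used, inlined.)
* **`exists_retraction`** — `∃ h p`, (dist) `h` is the distance to `Y`; (P1) `h v = 0 ↔ v ∈ Y`; (P2) parent step; (P3) every edge off `Y` is a parent edge;
  (P5) children: a non-parent neighbour `w` of `v ∉ Y` has `h w = h v + 1 ∧ p w = v`; (P4) equivariance under `Y`-preserving automorphisms.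

## References
* [Serre1980Trees] J.-P. Serre, *Trees*, Springer (1980): I.2.2 Prop. 8 (unique geodesics), I.2.3 (projection onto a subtree), I.6.4 Prop. 24–25.
* [Diestel2010] R. Diestel, *Graph Theory*, 4th ed., Thm. 1.5.1 (unique paths in trees), Prop. 1.5.2.
-/

set_option autoImplicit false

open SimpleGraph

namespace Literature.Combinatorics.SimpleGraph.TreeRetraction

variable {V : Type*} {G : SimpleGraph V}

/-- A walk of `G` between two points of `Y` all of whose vertices lie in `Y`, when `G.induce Y` is connected. [cite: Diestel2010, Prop. 1.5.2] -/
theorem exists_walk_mem_of_induce_connected {Y : Set V} (hY : (G.induce Y).Connected) {a b : V} (ha : a ∈ Y) (hb : b ∈ Y) :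
    ∃ q : G.Walk a b, ∀ x ∈ q.support, x ∈ Y := by
  obtain ⟨r⟩ := hY.preconnected ⟨a, ha⟩ ⟨b, hb⟩
  refine ⟨(r.map (Embedding.induce Y).toHom).copy rfl rfl, fun x hx => ?_⟩
  rw [Walk.support_copy, Walk.support_map, List.mem_map] at hx
  obtain ⟨z, -, rfl⟩ := hx
  exact z.2

/-- **THE RETRACTION ONTO A SUBTREE.**  For a tree `G` and a non-empty `Y ⊆ V` inducing a connected subgraph there are a height `h : V → ℕ` and a parent map
`p : V → V` with: (dist) `h v` is the distance from `v` to `Y`; (P1) `h v = 0 ↔ v ∈ Y`; (P2) for `v ∉ Y`, `v ~ p v` and `h (p v) + 1 = h v`; (P3) every edge `{v, w}` not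
inside `Y` is a parent edge: `(v ∉ Y ∧ p v = w) ∨ (w ∉ Y ∧ p w = v)`; (P5) a neighbour `w ≠ p v` of `v ∉ Y` is a child: `h w = h v + 1 ∧ p w = v`; (P4) for every
automorphism `φ` with `φ(Y) = Y`: `h (φ v) = h v` and `p (φ v) = φ (p v)` (`v ∉ Y`). [cite: Serre1980Trees, I.2.3, I.6.4 Prop. 24] [cite: Diestel2010, Thm. 1.5.1] -/
theorem exists_retraction (hT : G.IsTree) {Y : Set V} (hYne : Y.Nonempty) (hYc : (G.induce Y).Connected) :
    ∃ (h : V → ℕ) (p : V → V),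
      (∀ v, (∃ y ∈ Y, G.dist v y = h v) ∧ ∀ y ∈ Y, h v ≤ G.dist v y) ∧
      (∀ v, h v = 0 ↔ v ∈ Y) ∧
      (∀ v, v ∉ Y → G.Adj v (p v) ∧ h (p v) + 1 = h v) ∧
      (∀ v w, G.Adj v w → ¬ (v ∈ Y ∧ w ∈ Y) → (v ∉ Y ∧ p v = w) ∨ (w ∉ Y ∧ p w = v)) ∧
      (∀ v w, v ∉ Y → G.Adj v w → w ≠ p v → h w = h v + 1 ∧ p w = v) ∧
      (∀ φ : G ≃g G, (∀ v, φ v ∈ Y ↔ v ∈ Y) → ∀ v, h (φ v) = h v ∧ (v ∉ Y → p (φ v) = φ (p v))) := by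
  classical
  have hc : G.Connected := hT.1
  obtain ⟨y₀, hy₀⟩ := hYne
  -- the height: least `n` with a point of `Y` at distance `≤ n`
  have hex : ∀ v : V, ∃ n : ℕ, ∃ y ∈ Y, G.dist v y ≤ n := fun v => ⟨G.dist v y₀, y₀, hy₀, le_rfl⟩
  let h : V → ℕ := fun v => Nat.find (hex v)
  have hmin : ∀ v, ∀ y ∈ Y, h v ≤ G.dist v y := fun v y hy => Nat.find_min' (hex v) ⟨y, hy, le_rfl⟩
  have hatt : ∀ v, ∃ y ∈ Y, G.dist v y = h v := fun v => by
    obtain ⟨y, hy, hle⟩ := Nat.find_spec (hex v)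
    exact ⟨y, hy, le_antisymm hle (hmin v y hy)⟩
  have hzero : ∀ v, h v = 0 ↔ v ∈ Y := fun v => by
    constructor
    · intro h0
      obtain ⟨y, hy, hd⟩ := hatt v
      rw [h0, hc.dist_eq_zero_iff] at hd
      exact hd ▸ hy
    · intro hv
      have := hmin v v hv
      rw [dist_self] at this
      omega
  -- one step changes the height by at most one
  have hstep : ∀ v w, G.Adj v w → h w ≤ h v + 1 := fun v w hvw => by
    obtain ⟨y, hy, hd⟩ := hatt v
    have htri := hc.dist_triangle (u := w) (v := v) (w := y)
    rw [dist_eq_one_iff_adj.2 hvw.symm, hd] at htri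
    exact (hmin w y hy).trans (by omega)
  -- the down-neighbour
  have hdown : ∀ v, v ∉ Y → ∃ u, G.Adj v u ∧ h u + 1 = h v := fun v hv => by
    obtain ⟨y, hy, hd⟩ := hatt v
    have hvy : v ≠ y := fun hh => hv (hh ▸ hy)
    have hpos : 0 < G.dist v y := hc.pos_dist_of_ne hvy
    obtain ⟨q, hq⟩ := hc.exists_walk_length_eq_dist v y
    cases q with
    | nil => exact absurd rfl hvy
    | cons hadj q' =>
      rename_i u
      refine ⟨u, hadj, ?_⟩
      have h1 : G.dist u y ≤ q'.length := dist_le q'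
      have h2 : q'.length + 1 = h v := by rw [← hd, ← hq, Walk.length_cons]
      have h3 := hmin u y hy
      have h4 := hstep u v hadj.symm
      omega
  let p : V → V := fun v => if hv : v ∈ Y then v else Classical.choose (hdown v hv)
  have hp : ∀ v, v ∉ Y → G.Adj v (p v) ∧ h (p v) + 1 = h v := fun v hv => by
    simp only [p, dif_neg hv]
    exact Classical.choose_spec (hdown v hv)
  -- a shortest walk to `Y` from `x` cannot pass through a vertex `v` with `h v > h x − dist x v`; concretely:
  have havoid : ∀ (x y v : V), y ∈ Y → G.dist x y = h x → ∀ q : G.Walk x y, q.length = h x → x ≠ v → h x ≤ h v → v ∉ q.support := by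
    intro x y v hy hd q hq hxv hle hvq
    have hsplit := congrArg Walk.length (q.take_spec hvq)
    rw [Walk.length_append, hq] at hsplit
    have h1 : G.dist x v ≤ (q.takeUntil v hvq).length := dist_le _
    have h2 : G.dist v y ≤ (q.dropUntil v hvq).length := dist_le _
    have h3 : 0 < G.dist x v := hc.pos_dist_of_ne hxv
    have h4 := hmin v y hy
    omega
  -- KEY: for `v ∉ Y`, a neighbour `w ≠ p v` has `h w = h v + 1`
  have hkey : ∀ v w, v ∉ Y → G.Adj v w → w ≠ p v → h w = h v + 1 := by
    intro v w hv hvw hne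
    by_contra hcon
    have hwle : h w ≤ h v := by have := hstep v w hvw; omega
    obtain ⟨hvu, hhu⟩ := hp v hv
    set u := p v with hu
    -- shortest walks `u ⇝ yu`, `w ⇝ yw`, and a walk `yu ⇝ yw` inside `Y`; none passes through `v`
    obtain ⟨yu, hyu, hdu⟩ := hatt u
    obtain ⟨yw, hyw, hdw⟩ := hatt w
    obtain ⟨Pu, hPu⟩ := hc.exists_walk_length_eq_dist u yu
    obtain ⟨Pw, hPw⟩ := hc.exists_walk_length_eq_dist w yw
    obtain ⟨R, hR⟩ := exists_walk_mem_of_induce_connected hYc hyu hyw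
    have hvPu : v ∉ Pu.support := havoid u yu v hyu hdu Pu (by rw [hPu, hdu]) (G.ne_of_adj hvu).symm (by omega)
    have hvPw : v ∉ Pw.support := havoid w yw v hyw hdw Pw (by rw [hPw, hdw]) (G.ne_of_adj hvw).symm hwle
    have hvR : v ∉ R.support := fun hvR => hv (hR v hvR)
    let W : G.Walk u w := Pu.append (R.append Pw.reverse)
    have hvW : v ∉ W.support := by
      intro hvW
      rw [Walk.mem_support_append_iff, Walk.mem_support_append_iff, Walk.support_reverse, List.mem_reverse] at hvW
      rcases hvW with h1 | h2 | h3
      · exact hvPu h1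
      · exact hvR h2
      · exact hvPw h3
    -- two distinct paths `u ⇝ w`: through `v`, and `W.toPath` avoiding `v`
    have huw : u ≠ w := fun hh => hne hh.symm
    let T : G.Walk u w := Walk.cons hvu.symm (Walk.cons hvw Walk.nil)
    have hTpath : T.IsPath := by
      refine (Walk.cons_isPath_iff _ _).2 ⟨(Walk.cons_isPath_iff _ _).2 ⟨Walk.IsPath.nil, ?_⟩, ?_⟩
      · rw [Walk.support_nil, List.mem_singleton]; exact G.ne_of_adj hvw
      · rw [Walk.support_cons, Walk.support_nil, List.mem_cons, List.mem_singleton, not_or]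
        exact ⟨(G.ne_of_adj hvu).symm, huw⟩
    have heq := hT.isAcyclic.path_unique ⟨T, hTpath⟩ W.toPath
    have hvT : v ∈ (W.toPath : G.Walk u w).support := by
      rw [← heq]
      show v ∈ T.support
      rw [Walk.support_cons, List.mem_cons, Walk.support_cons, List.mem_cons]
      exact Or.inr (Or.inl rfl)
    exact hvW (Walk.support_toPath_subset_support W hvT)
  -- (P5) children
  have hchild : ∀ v w, v ∉ Y → G.Adj v w → w ≠ p v → h w = h v + 1 ∧ p w = v := by
    intro v w hv hvw hne
    have hhw := hkey v w hv hvw hne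
    refine ⟨hhw, ?_⟩
    have hw : w ∉ Y := fun hwY => by have := (hzero w).2 hwY; omega
    by_contra hne'
    have := hkey w v hw hvw.symm (Ne.symm hne')
    omega
  -- (P3) every edge off `Y` is a parent edge
  have hedge : ∀ v w, G.Adj v w → ¬ (v ∈ Y ∧ w ∈ Y) → (v ∉ Y ∧ p v = w) ∨ (w ∉ Y ∧ p w = v) := by
    intro v w hvw hnot
    by_cases hv : v ∈ Y
    · have hw : w ∉ Y := fun hw => hnot ⟨hv, hw⟩
      by_cases hpw : p w = v
      · exact Or.inr ⟨hw, hpw⟩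
      · have h1 := (hchild w v hw hvw.symm (Ne.symm hpw)).1
        have h2 := (hzero v).2 hv
        omega
    · by_cases hpv : p v = w
      · exact Or.inl ⟨hv, hpv⟩
      · exact Or.inr ⟨fun hwY => by have h1 := (hchild v w hv hvw (Ne.symm hpv)).1; have h2 := (hzero w).2 hwY; omega,
          (hchild v w hv hvw (Ne.symm hpv)).2⟩
  -- (P4) equivariance
  have hequiv : ∀ φ : G ≃g G, (∀ v, φ v ∈ Y ↔ v ∈ Y) → ∀ v, h (φ v) = h v ∧ (v ∉ Y → p (φ v) = φ (p v)) := by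
    intro φ hφY
    -- automorphisms do not increase distances (map a shortest walk); cf. ★ `Literature.Probability.MarkovChains.dist_iso`
    have hdistle : ∀ (ψ : G ≃g G) (a b : V), G.dist (ψ a) (ψ b) ≤ G.dist a b := fun ψ a b => by
      obtain ⟨q, hq⟩ := hc.exists_walk_length_eq_dist a b
      have hh := dist_le (q.map ψ.toEmbedding.toHom)
      rwa [Walk.length_map, hq] at hh
    have hhφ : ∀ (ψ : G ≃g G), (∀ v, ψ v ∈ Y ↔ v ∈ Y) → ∀ v, h (ψ v) ≤ h v := fun ψ hψY v => by
      obtain ⟨y, hy, hd⟩ := hatt v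
      have h1 := hmin (ψ v) (ψ y) ((hψY y).2 hy)
      have h2 := hdistle ψ v y
      rw [hd] at h2
      exact h1.trans h2
    have hsymm : ∀ v, φ.symm v ∈ Y ↔ v ∈ Y := fun v => by
      have := hφY (φ.symm v); rw [RelIso.apply_symm_apply] at this; exact this.symm
    have hheq : ∀ v, h (φ v) = h v := fun v =>
      le_antisymm (hhφ φ hφY v) (by have := hhφ φ.symm hsymm (φ v); rwa [RelIso.symm_apply_apply] at this)
    refine fun v => ⟨hheq v, fun hv => ?_⟩
    have hφv : φ v ∉ Y := fun hh => hv ((hφY v).1 hh)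
    obtain ⟨hvu, hhu⟩ := hp v hv
    by_contra hne
    have h1 := hkey (φ v) (φ (p v)) hφv ((Iso.map_adj_iff φ).2 hvu) (Ne.symm hne)
    rw [hheq, hheq] at h1
    omega
  exact ⟨h, p, fun v => ⟨hatt v, hmin v⟩, hzero, hp, hedge, hchild, hequiv⟩

end Literature.Combinatorics.SimpleGraph.TreeRetraction
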